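import Mathlib.Analysis.SpecialFunctions.Gamma.Beta
import Mathlib.NumberTheory.ZetaValues
import Mathlib.Analysis.Real.Pi.Bounds
import HarnessLib

/-!
# A uniform bound for `Γ(x + δ + iu)/Γ(x + iu)` in vertical strips

Topic: `Literature/Analysis/SpecialFunctions`. An elementary substitute for Stirling's formula in
vertical strips: for `0 < x₀ ≤ x ≤ 1`, `0 ≤ δ ≤ 1` and all real `u`,

  `‖Γ(x + δ + iu)‖ ≤ K(x₀) (1 + |u|)^δ ‖Γ(x + iu)‖`,

with an explicit `K(x₀) = exp M(x₀)`. (Stirling gives `|Γ(σ+it)| ~ √(2π)|t|^{σ-1/2}e^{-π|t|/2}`,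
whence the ratio is `≍ |t|^δ`; only this upper bound is needed for Báez-Duarte's Lemma 2.2,
`|ζ(1/2-ε+iτ)/ζ(1/2+ε+iτ)| ≪ (1+|τ|)^ε`, via the functional equation.)

## The argument

Euler's limit formula `Γ(s) = lim n^s n!/∏_{j=0}^n (s+j)` (Mathlib `Complex.GammaSeq_tendsto_Gamma`)
reduces the claim to `n^δ ∏_{j≤n} |z+j|/|w+j| ≤ K (1+|u|)^δ` for `z = x+iu`, `w = z+δ`, i.e. to
`δ log n + ∑_{j≤n} (log|z+j| - log|w+j|) ≤ log K + δ log(1+|u|)`. With `t = x + j`,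
`a = t²+u²`, `|w+j|² = a(1+y)`, `y = (2δt+δ²)/a`, one has
`log|z+j| - log|w+j| = -log(1+y)/2 ≤ -y/2 + y²/2 ≤ -δ t/a + δ C₁/t²` (`log(1+y) ≥ y - y²`), and
`t/a ≥ (log((t+1)²+u²) - log(t²+u²))/2 - 1/(2t²)` (`log(1+v) ≤ v`), which telescopes:
`∑ t_j/a_j ≥ log n - log(1+|u|) - S₀/2` with `∑_{j≤n} 1/(x+j)² ≤ S₀ = 1/x₀² + 2`.

## Main results (all proved)

* `Literature.Analysis.SpecialFunctions.GammaRatio.norm_GammaSeq_shift_le` — the bound for Euler's sequence, `n ≥ 1`.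
* `Literature.Analysis.SpecialFunctions.GammaRatio.norm_Gamma_shift_le` — the bound for `Γ`, explicit constant.
* `Literature.Analysis.SpecialFunctions.GammaRatio.exists_norm_Gamma_shift_le` — packaged form `∃ K > 0, …`.

## References

* E. C. Titchmarsh, *The Theory of the Riemann Zeta-Function*, 2nd ed. (1986), §4.12, (4.12.2)–
  (4.12.3) (the Stirling consequence `|χ(s)| ≍ (|t|/2π)^{1/2-σ}` that this bound replaces).
* H. Rademacher, *Topics in Analytic Number Theory* (1973), (21.51)–(21.52), as cited by
  Báez-Duarte (2003), Lemma 2.2.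
-/

noncomputable section

open Complex Filter Topology Finset

namespace Literature.Analysis.SpecialFunctions

namespace GammaRatio

/-- `y - y² ≤ log(1+y)` for `y ≥ 0` (from `1 - 1/v ≤ log v`). [folklore] -/
lemma sub_sq_le_log_one_add {y : ℝ} (hy : 0 ≤ y) : y - y ^ 2 ≤ Real.log (1 + y) := by
  have h := Real.one_sub_inv_le_log_of_pos (by linarith : (0 : ℝ) < 1 + y)
  have h2 : y - y ^ 2 ≤ 1 - (1 + y)⁻¹ := by
    have h3 : 1 - (1 + y)⁻¹ = y / (1 + y) := by
      field_simp
      ring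
    rw [h3, le_div_iff₀ (by linarith)]
    nlinarith [mul_nonneg hy (sq_nonneg y)]
  linarith

/-- The norm `‖t + iu‖`, squared, is `t² + u²`. [folklore] -/
lemma norm_sq_eq (t u : ℝ) : ‖(t : ℂ) + u * I‖ ^ 2 = t ^ 2 + u ^ 2 := by
  rw [Complex.norm_add_mul_I, Real.sq_sqrt (by positivity)]

/-- `log ‖t + iu‖ = log(t² + u²)/2`. [folklore] -/
lemma log_norm_eq (t u : ℝ) : Real.log ‖(t : ℂ) + u * I‖ = Real.log (t ^ 2 + u ^ 2) / 2 := by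
  rw [Complex.norm_add_mul_I, Real.log_sqrt (by positivity)]

/-- **Per-term upper bound.** For `0 < x₀ ≤ t`, `0 ≤ δ ≤ 1`:
`log|t+iu| - log|t+δ+iu| ≤ -δ t/(t²+u²) + δ ((2+1/x₀)²/2) t⁻²`. [folklore] -/
lemma log_norm_sub_log_norm_le {x₀ t δ u : ℝ} (hx₀ : 0 < x₀) (ht : x₀ ≤ t) (hδ : 0 ≤ δ)
    (hδ1 : δ ≤ 1) :
    Real.log ‖(t : ℂ) + u * I‖ - Real.log ‖((t + δ : ℝ) : ℂ) + u * I‖ ≤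
      -(δ * (t / (t ^ 2 + u ^ 2))) + δ * ((2 + 1 / x₀) ^ 2 / 2) * (1 / t ^ 2) := by
  have ht0 : 0 < t := hx₀.trans_le ht
  set a : ℝ := t ^ 2 + u ^ 2 with ha
  have hat : t ^ 2 ≤ a := by rw [ha]; nlinarith
  have ha0 : 0 < a := lt_of_lt_of_le (by positivity) hat
  set y : ℝ := (2 * δ * t + δ ^ 2) / a with hy
  have hy0 : 0 ≤ y := by positivity
  have hb : (t + δ) ^ 2 + u ^ 2 = a * (1 + y) := by
    rw [hy]
    field_simp
    ring
  rw [log_norm_eq, log_norm_eq, hb, Real.log_mul ha0.ne' (by positivity)]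
  have h1 := sub_sq_le_log_one_add hy0
  -- `δ t / a ≤ y / 2`
  have hyt : δ * (t / a) ≤ y / 2 := by
    have e : δ * (t / a) = (2 * δ * t) / (a * 2) := by
      field_simp
    rw [e, hy, div_div]
    exact div_le_div_of_nonneg_right (by nlinarith [sq_nonneg δ]) (by positivity)
  -- `y ≤ δ (2 + 1/x₀) / t`
  set c₀ : ℝ := 2 + 1 / x₀ with hc₀
  have hc₀0 : 0 < c₀ := by positivity
  have hnum : 2 * δ * t + δ ^ 2 ≤ δ * c₀ * t := by
    have h3 : δ ^ 2 ≤ δ * (1 / x₀) * t := by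
      have h4 : 1 ≤ (1 / x₀) * t := by
        rw [one_div, inv_mul_eq_div, le_div_iff₀ hx₀, one_mul]
        exact ht
      nlinarith
    rw [hc₀]
    nlinarith
  have hy_le : y ≤ δ * c₀ / t := by
    calc y ≤ (2 * δ * t + δ ^ 2) / t ^ 2 :=
          div_le_div_of_nonneg_left (by positivity) (by positivity) hat
      _ ≤ (δ * c₀ * t) / t ^ 2 := div_le_div_of_nonneg_right hnum (by positivity)
      _ = δ * c₀ / t := by field_simp
  have hy2 : y ^ 2 / 2 ≤ δ * (c₀ ^ 2 / 2) * (1 / t ^ 2) := by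
    have h5 : y ^ 2 ≤ (δ * c₀ / t) ^ 2 := pow_le_pow_left₀ hy0 hy_le 2
    have h6 : (δ * c₀ / t) ^ 2 = δ ^ 2 * (c₀ ^ 2 * (1 / t ^ 2)) := by
      field_simp
    have h7 : δ ^ 2 ≤ δ := by nlinarith
    have h8 : δ ^ 2 * (c₀ ^ 2 * (1 / t ^ 2)) ≤ δ * (c₀ ^ 2 * (1 / t ^ 2)) :=
      mul_le_mul_of_nonneg_right h7 (by positivity)
    nlinarith
  nlinarith

/-- **Per-term lower bound (telescoping form).** For `t > 0`:
`(log((t+1)²+u²) - log(t²+u²))/2 - 1/(2t²) ≤ t/(t²+u²)`. [folklore] -/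
lemma log_sub_log_div_two_le {t u : ℝ} (ht : 0 < t) :
    (Real.log ((t + 1) ^ 2 + u ^ 2) - Real.log (t ^ 2 + u ^ 2)) / 2 - 1 / (2 * t ^ 2) ≤
      t / (t ^ 2 + u ^ 2) := by
  set a : ℝ := t ^ 2 + u ^ 2 with ha
  have hat : t ^ 2 ≤ a := by rw [ha]; nlinarith
  have ha0 : 0 < a := lt_of_lt_of_le (by positivity) hat
  have ha' : (t + 1) ^ 2 + u ^ 2 = a * (1 + (2 * t + 1) / a) := by
    field_simp
    ring
  have hv : 0 < 1 + (2 * t + 1) / a := by positivity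
  rw [ha', Real.log_mul ha0.ne' hv.ne', add_sub_cancel_left]
  have h1 : Real.log (1 + (2 * t + 1) / a) ≤ (2 * t + 1) / a := by
    have := Real.log_le_sub_one_of_pos hv
    linarith
  have h2 : (2 * t + 1) / a / 2 - 1 / (2 * t ^ 2) ≤ t / a := by
    rw [show (2 * t + 1) / a / 2 = t / a + 1 / (2 * a) by field_simp]
    have : 1 / (2 * a) ≤ 1 / (2 * t ^ 2) :=
      div_le_div_of_nonneg_left zero_le_one (by positivity) (by linarith)
    linarith
  linarith

/-- `∑_{j ≤ n} (x+j)⁻² ≤ x₀⁻² + 2` for `x ≥ x₀ > 0` (`∑_{j≥1} j⁻² = π²/6 < 2`). [folklore] -/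
lemma sum_inv_sq_le {x₀ x : ℝ} (hx₀ : 0 < x₀) (hx : x₀ ≤ x) (n : ℕ) :
    ∑ j ∈ range (n + 1), 1 / (x + j) ^ 2 ≤ 1 / x₀ ^ 2 + 2 := by
  rw [Finset.sum_range_succ']
  simp only [Nat.cast_add, Nat.cast_one, CharP.cast_eq_zero, add_zero]
  have hx0 : 0 < x := hx₀.trans_le hx
  have h0 : 1 / x ^ 2 ≤ 1 / x₀ ^ 2 :=
    div_le_div_of_nonneg_left zero_le_one (by positivity) (pow_le_pow_left₀ hx₀.le hx 2)
  have h1 : ∑ j ∈ range n, 1 / (x + (j + 1)) ^ 2 ≤ ∑ j ∈ range n, 1 / ((j + 1 : ℕ) : ℝ) ^ 2 := by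
    refine Finset.sum_le_sum fun j _ ↦ ?_
    push_cast
    exact div_le_div_of_nonneg_left zero_le_one (by positivity)
      (pow_le_pow_left₀ (by positivity) (by linarith) 2)
  have h2 : ∑ j ∈ range n, 1 / ((j + 1 : ℕ) : ℝ) ^ 2 ≤ Real.pi ^ 2 / 6 := by
    have hs : HasSum (fun j : ℕ ↦ 1 / ((j + 1 : ℕ) : ℝ) ^ 2) (Real.pi ^ 2 / 6) := by
      refine (hasSum_nat_add_iff (f := fun j : ℕ ↦ 1 / (j : ℝ) ^ 2)
        (g := Real.pi ^ 2 / 6) 1).mpr ?_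
      simpa using hasSum_zeta_two
    exact sum_le_hasSum (range n) (fun j _ ↦ by positivity) hs
  have h3 : Real.pi ^ 2 / 6 ≤ 2 := by
    have := Real.pi_lt_d2
    have h4 := Real.pi_pos
    nlinarith
  linarith

/-- Norm of Euler's sequence: `‖n^s n!/∏(s+j)‖ = n^{re s} n!/∏‖s+j‖` (`n ≥ 1`). [folklore] -/
lemma norm_GammaSeq {s : ℂ} {n : ℕ} (hn : n ≠ 0) :
    ‖Complex.GammaSeq s n‖ = (n : ℝ) ^ s.re * n.factorial / ∏ j ∈ range (n + 1), ‖s + j‖ := by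
  rw [Complex.GammaSeq, norm_div, norm_mul, norm_prod,
    Complex.norm_natCast_cpow_of_pos (Nat.pos_of_ne_zero hn), Complex.norm_natCast]

/-- The explicit constant `M(x₀) = (x₀⁻² + 2)(1 + (2 + x₀⁻¹)²)/2` in the exponent. [folklore] -/
lemma constM_nonneg (x₀ : ℝ) : 0 ≤ (1 / x₀ ^ 2 + 2) * ((1 + (2 + 1 / x₀) ^ 2) / 2) := by
  positivity

/-- **The key logarithmic estimate.** For `0 < x₀ ≤ x ≤ 1`, `0 ≤ δ ≤ 1`, `n ≥ 1`, `z = x + iu`,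
`w = x + δ + iu`:
`δ log n + ∑_{j ≤ n} (log‖z+j‖ - log‖w+j‖) ≤ δ log(1+|u|) + M(x₀)`. [folklore] -/
lemma key_log_estimate {x₀ x δ u : ℝ} (hx₀ : 0 < x₀) (hx : x₀ ≤ x) (hx1 : x ≤ 1) (hδ : 0 ≤ δ)
    (hδ1 : δ ≤ 1) {n : ℕ} (hn : n ≠ 0) :
    δ * Real.log n + ∑ j ∈ range (n + 1),
        (Real.log ‖((x + j : ℝ) : ℂ) + u * I‖ - Real.log ‖((x + j + δ : ℝ) : ℂ) + u * I‖) ≤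
      δ * Real.log (1 + |u|) + (1 / x₀ ^ 2 + 2) * ((1 + (2 + 1 / x₀) ^ 2) / 2) := by
  have hx0 : 0 < x := hx₀.trans_le hx
  have hn1 : (1 : ℝ) ≤ n := by exact_mod_cast Nat.one_le_iff_ne_zero.mpr hn
  set S₀ : ℝ := 1 / x₀ ^ 2 + 2 with hS₀
  set C₁ : ℝ := (2 + 1 / x₀) ^ 2 / 2 with hC₁
  set F : ℕ → ℝ := fun j ↦ Real.log ((x + j) ^ 2 + u ^ 2) with hF
  -- (1) per-term upper bound
  have h1 : ∑ j ∈ range (n + 1),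
      (Real.log ‖((x + j : ℝ) : ℂ) + u * I‖ - Real.log ‖((x + j + δ : ℝ) : ℂ) + u * I‖) ≤
      ∑ j ∈ range (n + 1), (-(δ * ((x + j) / ((x + j) ^ 2 + u ^ 2))) +
        δ * C₁ * (1 / (x + j) ^ 2)) :=
    Finset.sum_le_sum fun j _ ↦ log_norm_sub_log_norm_le hx₀ (by linarith [j.cast_nonneg (α := ℝ)])
      hδ hδ1
  -- (2) per-term lower bound, telescoping
  have h2 : ∑ j ∈ range (n + 1), ((F (j + 1) - F j) / 2 - 1 / (2 * (x + j) ^ 2)) ≤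
      ∑ j ∈ range (n + 1), (x + j) / ((x + j) ^ 2 + u ^ 2) := by
    refine Finset.sum_le_sum fun j _ ↦ ?_
    have := log_sub_log_div_two_le (u := u) (by linarith [j.cast_nonneg (α := ℝ)] : 0 < x + j)
    simp only [hF, Nat.cast_add, Nat.cast_one]
    rw [add_assoc] at this
    exact this
  have htel : ∑ j ∈ range (n + 1), ((F (j + 1) - F j) / 2 - 1 / (2 * (x + j) ^ 2)) =
      (F (n + 1) - F 0) / 2 - (∑ j ∈ range (n + 1), 1 / (x + j) ^ 2) / 2 := by
    rw [Finset.sum_sub_distrib, ← Finset.sum_div, Finset.sum_range_sub, Finset.sum_div]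
    congr 1
    refine Finset.sum_congr rfl fun j _ ↦ ?_
    rw [div_div, mul_comm]
  -- (3) the sum of `1/(x+j)²`
  have h3 : ∑ j ∈ range (n + 1), 1 / (x + j) ^ 2 ≤ S₀ := sum_inv_sq_le hx₀ hx n
  -- (4) endpoint values of `F`
  have hF1 : 2 * Real.log n ≤ F (n + 1) := by
    simp only [hF]
    rw [← Real.log_rpow (by linarith), Real.rpow_two]
    refine Real.log_le_log (by positivity) ?_
    push_cast
    nlinarith [sq_nonneg u]
  have hF0 : F 0 ≤ 2 * Real.log (1 + |u|) := by
    simp only [hF, Nat.cast_zero, add_zero]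
    rw [← Real.log_rpow (by positivity), Real.rpow_two]
    refine Real.log_le_log (by positivity) ?_
    have hu : u ^ 2 = |u| ^ 2 := (sq_abs u).symm
    nlinarith [abs_nonneg u]
  -- assemble
  have hsum_g : Real.log n - Real.log (1 + |u|) - S₀ / 2 ≤
      ∑ j ∈ range (n + 1), (x + j) / ((x + j) ^ 2 + u ^ 2) := by
    have := h2
    rw [htel] at this
    linarith
  have hsplit : ∑ j ∈ range (n + 1), (-(δ * ((x + j) / ((x + j) ^ 2 + u ^ 2))) +
        δ * C₁ * (1 / (x + j) ^ 2)) =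
      -(δ * ∑ j ∈ range (n + 1), (x + j) / ((x + j) ^ 2 + u ^ 2)) +
        δ * C₁ * ∑ j ∈ range (n + 1), 1 / (x + j) ^ 2 := by
    rw [Finset.sum_add_distrib, Finset.sum_neg_distrib, Finset.mul_sum, Finset.mul_sum]
  rw [hsplit] at h1
  have hC₁0 : 0 ≤ C₁ := by positivity
  have hS₀0 : 0 ≤ S₀ := by positivity
  have hA : δ * C₁ * ∑ j ∈ range (n + 1), 1 / (x + j) ^ 2 ≤ δ * C₁ * S₀ :=
    mul_le_mul_of_nonneg_left h3 (by positivity)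
  have hB : -(δ * ∑ j ∈ range (n + 1), (x + j) / ((x + j) ^ 2 + u ^ 2)) ≤
      -(δ * (Real.log n - Real.log (1 + |u|) - S₀ / 2)) := by
    have := mul_le_mul_of_nonneg_left hsum_g hδ
    linarith
  have hM : δ * (S₀ / 2) + δ * C₁ * S₀ ≤ S₀ * ((1 + (2 + 1 / x₀) ^ 2) / 2) := by
    have : δ * (S₀ / 2) + δ * C₁ * S₀ = δ * (S₀ * ((1 + (2 + 1 / x₀) ^ 2) / 2)) := by
      rw [hC₁]; ring
    rw [this]
    have h0 : 0 ≤ S₀ * ((1 + (2 + 1 / x₀) ^ 2) / 2) := by positivity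
    nlinarith
  linarith

/-- **The ratio bound for Euler's sequence.** For `0 < x₀ ≤ x ≤ 1`, `0 ≤ δ ≤ 1`, real `u` and
`n ≥ 1`: `‖GammaSeq (x+δ+iu) n‖ ≤ e^{M(x₀)} (1+|u|)^δ ‖GammaSeq (x+iu) n‖`. [folklore] -/
theorem norm_GammaSeq_shift_le {x₀ x δ u : ℝ} (hx₀ : 0 < x₀) (hx : x₀ ≤ x) (hx1 : x ≤ 1)
    (hδ : 0 ≤ δ) (hδ1 : δ ≤ 1) {n : ℕ} (hn : n ≠ 0) :
    ‖Complex.GammaSeq (((x + δ : ℝ) : ℂ) + u * I) n‖ ≤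
      Real.exp ((1 / x₀ ^ 2 + 2) * ((1 + (2 + 1 / x₀) ^ 2) / 2)) * (1 + |u|) ^ δ *
        ‖Complex.GammaSeq ((x : ℂ) + u * I) n‖ := by
  have hx0 : 0 < x := hx₀.trans_le hx
  have hn0 : (0 : ℝ) < n := by exact_mod_cast Nat.pos_of_ne_zero hn
  set M : ℝ := (1 / x₀ ^ 2 + 2) * ((1 + (2 + 1 / x₀) ^ 2) / 2) with hMdef
  set z : ℂ := (x : ℂ) + u * I with hz
  set w : ℂ := ((x + δ : ℝ) : ℂ) + u * I with hw
  set Pz : ℝ := ∏ j ∈ range (n + 1), ‖z + j‖ with hPz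
  set Pw : ℝ := ∏ j ∈ range (n + 1), ‖w + j‖ with hPw
  have hzj : ∀ j : ℕ, z + j = (((x + j : ℝ)) : ℂ) + u * I := fun j ↦ by
    simp only [hz]; push_cast; ring
  have hwj : ∀ j : ℕ, w + j = (((x + j + δ : ℝ)) : ℂ) + u * I := fun j ↦ by
    simp only [hw]; push_cast; ring
  have hzj0 : ∀ j : ℕ, 0 < ‖z + j‖ := fun j ↦ by
    rw [hzj, Complex.norm_add_mul_I]
    exact Real.sqrt_pos.2 (by nlinarith [j.cast_nonneg (α := ℝ), sq_nonneg u])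
  have hwj0 : ∀ j : ℕ, 0 < ‖w + j‖ := fun j ↦ by
    rw [hwj, Complex.norm_add_mul_I]
    exact Real.sqrt_pos.2 (by nlinarith [j.cast_nonneg (α := ℝ), sq_nonneg u])
  have hPz0 : 0 < Pz := Finset.prod_pos fun j _ ↦ hzj0 j
  have hPw0 : 0 < Pw := Finset.prod_pos fun j _ ↦ hwj0 j
  -- the logarithmic estimate, exponentiated: `n^δ Pz ≤ e^M (1+|u|)^δ Pw`
  have hkey := key_log_estimate (u := u) hx₀ hx hx1 hδ hδ1 hn
  have hlogPz : Real.log Pz = ∑ j ∈ range (n + 1), Real.log ‖z + j‖ :=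
    Real.log_prod fun j _ ↦ (hzj0 j).ne'
  have hlogPw : Real.log Pw = ∑ j ∈ range (n + 1), Real.log ‖w + j‖ :=
    Real.log_prod fun j _ ↦ (hwj0 j).ne'
  have hu1 : 0 < 1 + |u| := by positivity
  have hprod : (n : ℝ) ^ δ * Pz ≤ Real.exp M * (1 + |u|) ^ δ * Pw := by
    have hl : Real.log ((n : ℝ) ^ δ * Pz) ≤ Real.log (Real.exp M * (1 + |u|) ^ δ * Pw) := by
      rw [Real.log_mul (by positivity) hPz0.ne', Real.log_rpow hn0, Real.log_mul (by positivity)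
        hPw0.ne', Real.log_mul (by positivity) (by positivity), Real.log_exp,
        Real.log_rpow hu1, hlogPz, hlogPw]
      have hsum : ∑ j ∈ range (n + 1), Real.log ‖z + j‖ - ∑ j ∈ range (n + 1), Real.log ‖w + j‖ =
          ∑ j ∈ range (n + 1), (Real.log ‖((x + j : ℝ) : ℂ) + u * I‖ -
            Real.log ‖((x + j + δ : ℝ) : ℂ) + u * I‖) := by
        rw [← Finset.sum_sub_distrib]
        exact Finset.sum_congr rfl fun j _ ↦ by rw [hzj, hwj]
      linarith [hsum]
    exact (Real.log_le_log_iff (by positivity) (by positivity)).1 hl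
  -- translate to `GammaSeq`
  rw [norm_GammaSeq hn, norm_GammaSeq hn]
  have hre_w : w.re = x + δ := by simp [hw]
  have hre_z : z.re = x := by simp [hz]
  rw [hre_w, hre_z, Real.rpow_add hn0]
  have hfac : (0 : ℝ) < n.factorial := by exact_mod_cast Nat.factorial_pos n
  rw [div_le_iff₀ hPw0]
  calc (n : ℝ) ^ x * (n : ℝ) ^ δ * n.factorial
      = ((n : ℝ) ^ δ * Pz) * ((n : ℝ) ^ x * n.factorial / Pz) := by
        field_simp
    _ ≤ (Real.exp M * (1 + |u|) ^ δ * Pw) * ((n : ℝ) ^ x * n.factorial / Pz) :=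
        mul_le_mul_of_nonneg_right hprod (by positivity)
    _ = Real.exp M * (1 + |u|) ^ δ * ((n : ℝ) ^ x * n.factorial / Pz) * Pw := by ring

/-- **Vertical ratio bound for `Γ`.** For `0 < x₀ ≤ x ≤ 1`, `0 ≤ δ ≤ 1` and real `u`:
`‖Γ(x+δ+iu)‖ ≤ e^{M(x₀)} (1+|u|)^δ ‖Γ(x+iu)‖`, `M(x₀) = (x₀⁻²+2)(1+(2+x₀⁻¹)²)/2` (a uniform
one-sided form of Stirling's `|Γ(x+δ+iu)/Γ(x+iu)| ~ |u|^δ`).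
[cite: Titchmarsh1986, §4.12 (4.12.3), consequence] -/
theorem norm_Gamma_shift_le {x₀ x δ u : ℝ} (hx₀ : 0 < x₀) (hx : x₀ ≤ x) (hx1 : x ≤ 1)
    (hδ : 0 ≤ δ) (hδ1 : δ ≤ 1) :
    ‖Complex.Gamma (((x + δ : ℝ) : ℂ) + u * I)‖ ≤
      Real.exp ((1 / x₀ ^ 2 + 2) * ((1 + (2 + 1 / x₀) ^ 2) / 2)) * (1 + |u|) ^ δ *
        ‖Complex.Gamma ((x : ℂ) + u * I)‖ := by
  have h1 := (Complex.GammaSeq_tendsto_Gamma (((x + δ : ℝ) : ℂ) + u * I)).norm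
  have h2 := ((Complex.GammaSeq_tendsto_Gamma ((x : ℂ) + u * I)).norm).const_mul
    (Real.exp ((1 / x₀ ^ 2 + 2) * ((1 + (2 + 1 / x₀) ^ 2) / 2)) * (1 + |u|) ^ δ)
  refine le_of_tendsto_of_tendsto h1 h2 ?_
  filter_upwards [eventually_ne_atTop 0] with n hn
  exact norm_GammaSeq_shift_le hx₀ hx hx1 hδ hδ1 hn

/-- **Vertical ratio bound for `Γ`, packaged**: for `x₀ > 0` there is `K > 0` with
`‖Γ(x+δ+iu)‖ ≤ K (1+|u|)^δ ‖Γ(x+iu)‖` whenever `x₀ ≤ x ≤ 1`, `0 ≤ δ ≤ 1`, `u ∈ ℝ`.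
[cite: Titchmarsh1986, §4.12 (4.12.3), consequence] -/
theorem exists_norm_Gamma_shift_le {x₀ : ℝ} (hx₀ : 0 < x₀) :
    ∃ K : ℝ, 0 < K ∧ ∀ x δ u : ℝ, x₀ ≤ x → x ≤ 1 → 0 ≤ δ → δ ≤ 1 →
      ‖Complex.Gamma (((x + δ : ℝ) : ℂ) + u * I)‖ ≤ K * (1 + |u|) ^ δ *
        ‖Complex.Gamma ((x : ℂ) + u * I)‖ :=
  ⟨_, Real.exp_pos _, fun _ _ _ hx hx1 hδ hδ1 ↦ norm_Gamma_shift_le hx₀ hx hx1 hδ hδ1⟩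

end GammaRatio

end Literature.Analysis.SpecialFunctions

end
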